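import Summits.QuantumFields.BalabanUV.Beta.EriceFlowEnclosureB12AsPrintedPointwiseFaceDrift
import Summits.QuantumFields.BalabanUV.Beta.EriceFlowEnclosureB12AsPrintedPointwiseFading

/-!
# Beta / EriceFlowEnclosureB12AsPrintedPointwiseFadingDrift — WHAT (0.31) FORCES, part 10: THE TYPED THEOREM 2 + node U2's COUPLING-CHART FADING MEMORY FORCE
# crew CAP's AVERAGED-AF CARRIER NEAR ZERO — no uniform reading (part 6d #60e), no (AF-1) (part 9b #61j), no sign, no NE4.  Part 9b moved each β-value of a tuned run to the FACE
# g_k = 0 by (AF-1) at cost C·r_j and summed the costs by the √N law of an asymptotically free window; here the β-value is moved to the CONSTANT HISTORY (δ, …, δ) by node U2's moduli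
# `T4CouplingMatching.HistLipschitz Λ γ β` with `FadingMemory C θ Λ` (θ < 1) at cost `Σ_{i≤j} Cθ^{j−i}|r_i − δ| ≤ Cδ∕(1−θ) + CΣ_{i≤j}θ^{j−i}r_i`: inside the window the exchanged double sum is
# `≤ (C∕(1−θ))Σ_{j∈window} r_j ≤ (C∕(1−θ))·2√N∕√s` (#61j `sum_run_le_of_discrete031` BY NAME), the pre-window history fades out (`≤ Cγθ∕(1−θ)²`).  Since the reference sequence
# `b_j := β_{j+1}(δ, …, δ)` does not depend on the endpoint g, ONE admissible endpoint of the TYPED Theorem 2 suffices (its constants β(g₁), β′(g₁)): **`constDrift_of_runs`** (two-sided linear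
# drift of b with defect `(Cδ∕(1−θ))N + A√N + B`), **`betaAvgAFH_of_runs_fadingMemory`** (`BetaAvgAFH (s∕4) D δ β` once `4Cδ ≤ s(1−θ)`), and on the as-printed carrier
# **`betaAvgAFH_of_theorem2_fadingMemory`**: `Theorem2Statement S hL` AS TYPED + `hrg` + the moduli ⟹ ∃ s > 0, D with `BetaAvgAFH (s∕4) D δ S.β` for every small box δ — the letter socket e3's
# certified slice instantiates is NECESSARY for [I] Theorem 2 EVEN AS TYPED under node U2's moduli ALONE; equivalently the typed (0.31)'s lower half is automatically g-UNIFORM up to a defect on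
# small boxes.  NOT pointwise (part 8b's ramp #61g: every hypothesis here, β_2(δ, δ∕3) < 0); part 10b (`…PointwiseFadingEventualAF`) adds NE4 and gets the EVENTUAL pointwise letter
# (β-flow team, prover 2 = lower ∕ positivity side, unit `b2b-balaban-beta-bflow-p2`, gen 46; ROW AP-I × node U2's letters × crew CAP's carrier `Beta.AveragedAFCarrier.BetaAvgAFH` = socket e3)

HONEST FRAMING (page 1 of everything the β sub-cell writes): discharging `BetaPertH` makes Bałaban's UV stability UNCONDITIONAL — a
real constructive-QFT result; it is NOT the continuum limit and NOT the Clay problem.  HONEST DEPENDENCY (cell reorg 2026-08-19,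
verbatim): «continuum YM on T⁴ ⇐ BetaPertH ∧ nine spine estimates (0/9 proved); BetaPertH ⇐ (D1) ∧ (D4) ∧ CAP+tail; G-an2-4 gates
asym, D1 and NE2/3/4.»  THIS MODULE DISCHARGES NOTHING: §1–§3 are [folklore] finite-sum calculus for an ABSTRACT `β : FlowStep.HBeta` under node U2's HYPOTHESIS SHAPES
`T4CouplingMatching.HistLipschitz ∕ FadingMemory` (NOT printed — [Balaban1987RG1] = T. Bałaban, Commun. Math. Phys. **109** (1987) p. 298 says only that β_j *"depends also on all
preceding coupling constants"*; GAPS G-t4-U2-2) and a displayed family of runs obeying the printed recursion (0.20) p. 256 (`FlowStep.RGEqH`) and the discrete two-sided (0.31) p. 259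
(`Step.Discrete031`); §4 is bookkeeping BY NAME over the NAMED FIELDS of the statement-exact typing `B12BetaAsPrinted` (`Theorem2Statement` — Theorem 2 is STATED WITHOUT PROOF in print,
p. 259; [Balaban1989LargeFieldII] p. 355 «has not been published yet» — a HYPOTHESIS) with prover 1's binder `hrg` ∕ the upper letter (U); crew CAP's `BetaAvgAFH` is a HYPOTHESIS SHAPE of the
tree, here a CONCLUSION for an abstract setting — for Bałaban's (1.22) every instance remains a located UNPRINTED input (BETA-SPEC §7).  Nothing of Bałaban's objects is asserted.

WHAT THIS FILE PROVES (0 sorry, 0 def):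
§1 `sum_Ico_sum_range_geom_split_le` (the exchanged geometric double sum, split at the window), **`abs_sub_const_le`** (transfer of β_{j+1}(r_{≤j}) to β_{j+1}(δ,…,δ): ≤ Cδ∕(1−θ) +
   CΣ_{i≤j}θ^{j−i}r_i), `abs_sub_const_le_of_small` (a ]0,δ]-history: ≤ Cδ∕(1−θ)).
§2 **`constDrift_window`** (one lattice, one window: `s·N − E ≤ Σ_{j∈[k,K)} β_{j+1}(δ,…,δ) ≤ s′·N + E`, `E = (Cδ∕(1−θ))N + (2C∕((1−θ)√s))√N + Cγθ∕(1−θ)²`).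
§3 **`constDrift_of_runs`** (all windows from one run per depth), `sqrt_absorb`, **`betaAvgAFH_of_runs_fadingMemory`** (`BetaAvgAFH (s∕4) (4C²∕((1−θ)²s²) + Cγθ∕(1−θ)²) δ β` for `4Cδ ≤ s(1−θ)`).
§4 `runs_of_theorem2` (the typed Theorem 2 + `hrg` ⟹ the run family at ONE endpoint), **`betaAvgAFH_of_theorem2_fadingMemory`** (THE END), `exists_betaAvgAFH_of_theorem2_fadingMemory` (∃ s > 0 ∃ D
   ∃ δ > 0), `exists_betaAvgAFH_of_theorem2_fadingMemory'` (`hrg` discharged from `Definitions` + (U), `…TunedUpper.hrg_of_betaUpperH`).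
§5 `lower_running_of_avgAFH_run` (the carrier along any run: (0.31)'s lower half with a defect), **`uniformLowerRunning_of_theorem2_fadingMemory`** (AUTOMATIC UNIFORMITY: one slope, one defect for
   EVERY run of the setting in the small box).
NOT CLAIMED: any instance of `BetaAvgAFH`, any modulus, sign or bound for Bałaban's β; which reading print intends; Theorem 2; `BetaPertH`; continuum; Clay.
-/

namespace Summit.QuantumFields.BalabanUV.Beta.EriceFlowEnclosureB12AsPrintedPointwiseFadingDrift

open Finset
open Literature.MathematicalPhysics.QuantumFieldTheory.Balaban1983to89
open Literature.MathematicalPhysics.QuantumFieldTheory.Balaban1983to89.B12BetaAsPrinted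
open Literature.MathematicalPhysics.QuantumFieldTheory.Balaban1983to89.FlowStep (HBeta prefixOf Box mem_box box_mono RGEqH BetaUpperH
  inv_sq_telescopeH)
open Literature.MathematicalPhysics.QuantumFieldTheory.Balaban1983to89.T4CouplingMatching (HistLipschitz FadingMemory)
open Literature.MathematicalPhysics.QuantumFieldTheory.Balaban1983to89.Beta.AveragedAFCarrier (BetaAvgAFH)
open Summit.QuantumFields.BalabanUV.Beta.EriceFlowEnclosureB12AsPrintedUpper (tunedRuns_of_theorem2Statement)
open Summit.QuantumFields.BalabanUV.Beta.EriceFlowEnclosureB12AsPrintedTunedUpper (hrg_of_betaUpperH prefixOf_mem_box_of_inInterval)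
open Summit.QuantumFields.BalabanUV.Beta.EriceFlowEnclosureB12AsPrintedPointwiseFaceDrift (sum_run_le_of_discrete031)
open Summit.QuantumFields.BalabanUV.Beta.EriceFlowEnclosureB12AsPrintedPointwiseFading (rowSum_le)

noncomputable section

/-! ## §1 Two finite-sum lemmas: the split exchanged double sum, and the coupling-chart transfer to the constant history -/

/-- **The split exchanged double sum.**  For `0 ≤ θ < 1`, weights `u_i ≥ 0` below `K` with `u_i ≤ M` before the window (`i < k`, `0 ≤ M`):
`Σ_{j∈[k,K)} Σ_{i≤j} θ^{j−i} u_i ≤ (1∕(1−θ)) Σ_{i∈[k,K)} u_i + Mθ∕(1−θ)²` — inside the window the rows are exchanged (`Σ_{j≥i} θ^{j−i} ≤ 1∕(1−θ)`), before it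
each row costs `M θ^{j+1−k}∕(1−θ)`. [folklore] -/
theorem sum_Ico_sum_range_geom_split_le {θ M : ℝ} {u : ℕ → ℝ} (hθ0 : 0 ≤ θ) (hθ1 : θ < 1) (hM : 0 ≤ M) {k K : ℕ}
    (hu : ∀ i, i < K → 0 ≤ u i) (huM : ∀ i, i < k → u i ≤ M) :
    ∑ j ∈ Ico k K, ∑ i ∈ range (j + 1), θ ^ (j - i) * u i ≤
      1 / (1 - θ) * ∑ i ∈ Ico k K, u i + M * θ / (1 - θ) ^ 2 := by
  have h1θ : 0 < 1 - θ := by linarith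
  -- split each inner sum at k
  have hsplit : ∀ j ∈ Ico k K, ∑ i ∈ range (j + 1), θ ^ (j - i) * u i =
      ∑ i ∈ range k, θ ^ (j - i) * u i + ∑ i ∈ Ico k (j + 1), θ ^ (j - i) * u i := by
    intro j hj
    have hkj : k ≤ j + 1 := by have := (mem_Ico.mp hj).1; omega
    rw [Finset.range_eq_Ico, ← Finset.sum_Ico_consecutive _ (Nat.zero_le k) hkj, Finset.range_eq_Ico]
  rw [Finset.sum_congr rfl hsplit, Finset.sum_add_distrib]
  -- part 1: the pre-window history
  have hpre : ∑ j ∈ Ico k K, ∑ i ∈ range k, θ ^ (j - i) * u i ≤ M * θ / (1 - θ) ^ 2 := by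
    have hrow : ∀ j ∈ Ico k K, ∑ i ∈ range k, θ ^ (j - i) * u i ≤ M * (θ ^ (j + 1 - k) / (1 - θ)) := by
      intro j hj
      have hkj : k ≤ j := (mem_Ico.mp hj).1
      calc ∑ i ∈ range k, θ ^ (j - i) * u i ≤ ∑ i ∈ range k, θ ^ (j - i) * M :=
            Finset.sum_le_sum fun i hi => mul_le_mul_of_nonneg_left (huM i (mem_range.mp hi)) (pow_nonneg hθ0 _)
        _ = M * ∑ i ∈ range k, θ ^ (j - i) := by rw [Finset.mul_sum]; exact Finset.sum_congr rfl fun i _ => mul_comm _ _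
        _ = M * ∑ i ∈ range k, θ ^ (j + 1 - k + i) := by
            congr 1
            rw [← Finset.sum_range_reflect (fun i => θ ^ (j - i)) k]
            exact Finset.sum_congr rfl fun i hi => by rw [show j - (k - 1 - i) = j + 1 - k + i by have := mem_range.mp hi; omega]
        _ = M * (θ ^ (j + 1 - k) * ∑ i ∈ range k, θ ^ i) := by
            congr 1; rw [Finset.mul_sum]; exact Finset.sum_congr rfl fun i _ => by rw [pow_add]
        _ ≤ M * (θ ^ (j + 1 - k) / (1 - θ)) := by
            refine mul_le_mul_of_nonneg_left ?_ hM
            rw [div_eq_mul_one_div]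
            refine mul_le_mul_of_nonneg_left ?_ (pow_nonneg hθ0 _)
            have h := geom_sum_Ico_le_of_lt_one (m := 0) (n := k) hθ0 hθ1
            rwa [Nat.Ico_zero_eq_range, pow_zero] at h
    calc ∑ j ∈ Ico k K, ∑ i ∈ range k, θ ^ (j - i) * u i ≤ ∑ j ∈ Ico k K, M * (θ ^ (j + 1 - k) / (1 - θ)) :=
          Finset.sum_le_sum hrow
      _ = M / (1 - θ) * (θ * ∑ j ∈ Ico k K, θ ^ (j - k)) := by
          rw [Finset.mul_sum, Finset.mul_sum]
          exact Finset.sum_congr rfl fun j hj => by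
            rw [show j + 1 - k = (j - k) + 1 by have := (mem_Ico.mp hj).1; omega, pow_succ]; ring
      _ ≤ M / (1 - θ) * (θ * (1 / (1 - θ))) := by
          refine mul_le_mul_of_nonneg_left (mul_le_mul_of_nonneg_left ?_ hθ0) (div_nonneg hM h1θ.le)
          rw [Finset.sum_Ico_eq_sum_range]
          have h := geom_sum_Ico_le_of_lt_one (m := 0) (n := K - k) hθ0 hθ1
          rw [Nat.Ico_zero_eq_range, pow_zero] at h
          refine le_trans (le_of_eq ?_) h
          exact Finset.sum_congr rfl fun d _ => by rw [Nat.add_sub_cancel_left]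
      _ = M * θ / (1 - θ) ^ 2 := by field_simp
  -- part 2: inside the window, exchange the sums
  have hin : ∑ j ∈ Ico k K, ∑ i ∈ Ico k (j + 1), θ ^ (j - i) * u i ≤ 1 / (1 - θ) * ∑ i ∈ Ico k K, u i := by
    have hswap : ∑ j ∈ Ico k K, ∑ i ∈ Ico k (j + 1), θ ^ (j - i) * u i =
        ∑ i ∈ Ico k K, ∑ j ∈ Ico i K, θ ^ (j - i) * u i := by
      refine Finset.sum_comm' fun j i => ?_
      simp only [mem_Ico]
      omega
    rw [hswap, Finset.mul_sum]
    refine Finset.sum_le_sum fun i hi => ?_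
    have hiK : i < K := (mem_Ico.mp hi).2
    rw [← Finset.sum_mul, mul_comm (1 / (1 - θ)) (u i), mul_comm]
    refine mul_le_mul_of_nonneg_left ?_ (hu i hiK)
    have h := geom_sum_Ico_le_of_lt_one (m := 0) (n := K - i) hθ0 hθ1
    rw [Nat.Ico_zero_eq_range, pow_zero] at h
    rw [Finset.sum_Ico_eq_sum_range]
    refine le_trans (le_of_eq ?_) h
    exact Finset.sum_congr rfl fun d _ => by rw [Nat.add_sub_cancel_left]
  linarith [hpre, hin]

/-- **The coupling-chart transfer of one β-value to the CONSTANT history** `(δ, …, δ)`: under node U2's moduli `HistLipschitz Λ γ β` with `FadingMemory C θ Λ` (0 ≤ θ < 1),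
for a history `(r_0, …, r_j) ∈ ]0, γ]^{j+1}` and `0 < δ ≤ γ`, `|β_{j+1}(r_0, …, r_j) − β_{j+1}(δ, …, δ)| ≤ Cδ∕(1−θ) + C Σ_{i≤j} θ^{j−i} r_i` (each coordinate differs by at most
`r_i + δ`; the row sum of the moduli is ≤ C∕(1−θ), `…PointwiseFading.rowSum_le`). [folklore] -/
theorem abs_sub_const_le {β : HBeta} {γ C θ δ : ℝ} {Λ : ℕ → ℕ → ℝ} (hL : HistLipschitz Λ γ β) (hΛ : FadingMemory C θ Λ)
    (hθ0 : 0 ≤ θ) (hθ1 : θ < 1) (hC : 0 ≤ C) (hδ : 0 < δ) (hδγ : δ ≤ γ) {j : ℕ} {r : ℕ → ℝ} (hr : prefixOf r j ∈ Box γ j) :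
    |β j (prefixOf r j) - β j (fun _ : Fin (j + 1) => δ)| ≤ C * δ / (1 - θ) + C * ∑ i ∈ range (j + 1), θ ^ (j - i) * r i := by
  have hconst : (fun _ : Fin (j + 1) => δ) ∈ Box γ j := mem_box.mpr fun _ => ⟨hδ, hδγ⟩
  have h := hL j (prefixOf r j) (fun _ => δ) hr hconst
  have hri : ∀ i : Fin (j + 1), 0 < r i := fun i => by simpa using (mem_box.mp hr i).1
  -- each coordinate differs by at most r_i + δ
  have hterm : ∀ i : Fin (j + 1), Λ j i * |prefixOf r j i - δ| ≤ Λ j i * r i + Λ j i * δ := by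
    intro i
    have hΛi : 0 ≤ Λ j i := (hΛ j i (Nat.le_of_lt_succ i.isLt)).1
    have habs : |prefixOf r j i - δ| ≤ r i + δ := by
      rw [FlowStep.prefixOf_apply]
      exact abs_sub_le_iff.mpr ⟨by linarith [hri i], by linarith [hri i]⟩
    calc Λ j i * |prefixOf r j i - δ| ≤ Λ j i * (r i + δ) := mul_le_mul_of_nonneg_left habs hΛi
      _ = Λ j i * r i + Λ j i * δ := by ring
  have hsum : ∑ i : Fin (j + 1), Λ j i * |prefixOf r j i - δ| ≤
      ∑ i : Fin (j + 1), Λ j i * r i + δ * ∑ i : Fin (j + 1), Λ j i := by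
    calc ∑ i : Fin (j + 1), Λ j i * |prefixOf r j i - δ| ≤ ∑ i : Fin (j + 1), (Λ j i * r i + Λ j i * δ) := Finset.sum_le_sum fun i _ => hterm i
      _ = ∑ i : Fin (j + 1), Λ j i * r i + δ * ∑ i : Fin (j + 1), Λ j i := by
          rw [Finset.sum_add_distrib, Finset.mul_sum]
          exact congrArg _ (Finset.sum_congr rfl fun i _ => mul_comm _ _)
  -- the weighted sum against the fading profile, and the row sum
  have hfad : ∑ i : Fin (j + 1), Λ j i * r i ≤ C * ∑ i ∈ range (j + 1), θ ^ (j - i) * r i := by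
    rw [Finset.mul_sum, Fin.sum_univ_eq_sum_range (fun i => Λ j i * r i) (j + 1)]
    refine Finset.sum_le_sum fun i hi => ?_
    have hij : i ≤ j := Nat.le_of_lt_succ (mem_range.mp hi)
    have hri' : 0 ≤ r i := by
      have := (mem_box.mp hr ⟨i, mem_range.mp hi⟩).1
      simp only [FlowStep.prefixOf_apply] at this
      exact this.le
    calc Λ j i * r i ≤ C * θ ^ (j - i) * r i := mul_le_mul_of_nonneg_right (hΛ j i hij).2 hri'
      _ = C * (θ ^ (j - i) * r i) := by ring
  have hrow := rowSum_le hθ0 hθ1 hC hΛ j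
  have hδrow : δ * ∑ i : Fin (j + 1), Λ j i ≤ C * δ / (1 - θ) := by
    calc δ * ∑ i : Fin (j + 1), Λ j i ≤ δ * (C / (1 - θ)) := mul_le_mul_of_nonneg_left hrow hδ.le
      _ = C * δ / (1 - θ) := by ring
  linarith [h, hsum, hfad, hδrow]

/-- The transfer of one β-value of a `]0, δ]`-history to the constant history costs only `Cδ∕(1−θ)` (each coordinate differs by at most δ). [folklore] -/
theorem abs_sub_const_le_of_small {β : HBeta} {γ C θ δ : ℝ} {Λ : ℕ → ℕ → ℝ} (hL : HistLipschitz Λ γ β) (hΛ : FadingMemory C θ Λ)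
    (hθ0 : 0 ≤ θ) (hθ1 : θ < 1) (hC : 0 ≤ C) (hδ : 0 < δ) (hδγ : δ ≤ γ) {j : ℕ} {v : ℕ → ℝ} (hv : ∀ i, 0 < v i ∧ v i ≤ δ) :
    |β j (prefixOf v j) - β j (fun _ : Fin (j + 1) => δ)| ≤ C * δ / (1 - θ) := by
  have hconst : (fun _ : Fin (j + 1) => δ) ∈ Box γ j := mem_box.mpr fun _ => ⟨hδ, hδγ⟩
  have hvbox : prefixOf v j ∈ Box γ j := mem_box.mpr fun i => ⟨(hv i).1, (hv i).2.trans hδγ⟩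
  have h := hL j (prefixOf v j) (fun _ => δ) hvbox hconst
  have hterm : ∀ i : Fin (j + 1), Λ j i * |prefixOf v j i - δ| ≤ Λ j i * δ := by
    intro i
    have hΛi : 0 ≤ Λ j i := (hΛ j i (Nat.le_of_lt_succ i.isLt)).1
    have habs : |prefixOf v j i - δ| ≤ δ := by
      rw [FlowStep.prefixOf_apply]
      exact abs_sub_le_iff.mpr ⟨by linarith [(hv i).2], by linarith [(hv i).1]⟩
    exact mul_le_mul_of_nonneg_left habs hΛi
  have hsum : ∑ i : Fin (j + 1), Λ j i * |prefixOf v j i - δ| ≤ δ * ∑ i : Fin (j + 1), Λ j i := by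
    calc ∑ i : Fin (j + 1), Λ j i * |prefixOf v j i - δ| ≤ ∑ i : Fin (j + 1), Λ j i * δ := Finset.sum_le_sum fun i _ => hterm i
      _ = δ * ∑ i : Fin (j + 1), Λ j i := by rw [Finset.mul_sum]; exact Finset.sum_congr rfl fun i _ => mul_comm _ _
  have hrow := rowSum_le hθ0 hθ1 hC hΛ j
  have hδrow : δ * ∑ i : Fin (j + 1), Λ j i ≤ C * δ / (1 - θ) := by
    calc δ * ∑ i : Fin (j + 1), Λ j i ≤ δ * (C / (1 - θ)) := mul_le_mul_of_nonneg_left hrow hδ.le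
      _ = C * δ / (1 - θ) := by ring
  linarith [h, hsum, hδrow]

/-! ## §2 One lattice, one window: the constant-history sequence against the window of a (0.31)-run -/

/-- **ONE LATTICE, ONE WINDOW.**  Under node U2's moduli on ]0, γ] (0 ≤ θ < 1) and `0 < δ ≤ γ`: a run r of (0.20) (`RGEqH K`) inside ]0, γ] with `Step.Discrete031 s s′ K (r_K) r`, s > 0,
satisfies for every k ≤ K, with `b_j := β_{j+1}(δ, …, δ)` and `N := K − k`,
`s·N − E ≤ Σ_{j∈[k,K)} b_j ≤ s′·N + E`, `E := (Cδ∕(1−θ))·N + (2C∕((1−θ)√s))·√N + Cγθ∕(1−θ)²`: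
telescoped (0.20) + (0.31) at scale k give the window of the run's β-values in `[sN, s′N]`, §1 moves each to the constant history at cost `Cδ∕(1−θ) + CΣ_{i≤j}θ^{j−i}r_i`, the double sum
is split at k (`sum_Ico_sum_range_geom_split_le`, pre-window couplings ≤ γ) and the run is summably small over the window by (0.31)'s own asymptotic freedom (#61j `sum_run_le_of_discrete031` BY NAME:
`Σ_{j∈[k,K)} r_j ≤ 2√N∕√s`). [cite: Balaban1987RG1, (0.20) p.256, (0.31) p.259, §5 p.298] -/
theorem constDrift_window {β : HBeta} {γ C θ δ s s' : ℝ} {Λ : ℕ → ℕ → ℝ} (hL : HistLipschitz Λ γ β) (hΛ : FadingMemory C θ Λ)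
    (hθ0 : 0 ≤ θ) (hθ1 : θ < 1) (hC : 0 ≤ C) (hδ : 0 < δ) (hδγ : δ ≤ γ) (hs : 0 < s)
    {K : ℕ} {r : ℕ → ℝ} (hrg : RGEqH K β r) (hI : Step.InInterval γ K r) (hD : Step.Discrete031 s s' K (r K) r) {k : ℕ} (hk : k ≤ K) :
    s * ((K : ℝ) - k) - (C * δ / (1 - θ) * ((K : ℝ) - k) + 2 * C / ((1 - θ) * Real.sqrt s) * Real.sqrt ((K : ℝ) - k)
        + C * γ * θ / (1 - θ) ^ 2) ≤ ∑ j ∈ Ico k K, β j (fun _ : Fin (j + 1) => δ) ∧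
      ∑ j ∈ Ico k K, β j (fun _ : Fin (j + 1) => δ) ≤ s' * ((K : ℝ) - k) + (C * δ / (1 - θ) * ((K : ℝ) - k)
        + 2 * C / ((1 - θ) * Real.sqrt s) * Real.sqrt ((K : ℝ) - k) + C * γ * θ / (1 - θ) ^ 2) := by
  have h1θ : 0 < 1 - θ := by linarith
  have hγ : 0 < γ := hδ.trans_le hδγ
  -- telescoped window of the run's β-values, and (0.31) at scale k
  have htel := inv_sq_telescopeH hrg hk le_rfl
  have h31 := hD k hk
  -- per-term transfer to the constant history
  have hterm : ∀ j ∈ Ico k K, |β j (prefixOf r j) - β j (fun _ : Fin (j + 1) => δ)| ≤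
      C * δ / (1 - θ) + C * ∑ i ∈ range (j + 1), θ ^ (j - i) * r i := by
    intro j hj
    have hjK : j < K := (mem_Ico.mp hj).2
    exact abs_sub_const_le hL hΛ hθ0 hθ1 hC hδ hδγ (prefixOf_mem_box_of_inInterval hI hjK.le)
  have habs : |∑ j ∈ Ico k K, β j (prefixOf r j) - ∑ j ∈ Ico k K, β j (fun _ : Fin (j + 1) => δ)|
      ≤ ∑ j ∈ Ico k K, (C * δ / (1 - θ) + C * ∑ i ∈ range (j + 1), θ ^ (j - i) * r i) := by
    rw [← Finset.sum_sub_distrib]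
    exact (Finset.abs_sum_le_sum_abs _ _).trans (Finset.sum_le_sum hterm)
  rw [Finset.sum_add_distrib, Finset.sum_const, Nat.card_Ico, nsmul_eq_mul, ← Finset.mul_sum] at habs
  -- the split exchanged double sum and the square-root law for the run
  have hdouble := sum_Ico_sum_range_geom_split_le (u := r) hθ0 hθ1 hγ.le (k := k) (K := K)
    (fun i hi => (hI i hi.le).1.le) (fun i hi => (hI i (by omega)).2)
  have hsqrt := sum_run_le_of_discrete031 hs (fun i hi => (hI i hi).1) hD hk
  have hcast : (((K - k : ℕ) : ℝ)) = (K : ℝ) - k := Nat.cast_sub hk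
  rw [hcast] at habs
  have hCd : C * ∑ j ∈ Ico k K, ∑ i ∈ range (j + 1), θ ^ (j - i) * r i ≤
      2 * C / ((1 - θ) * Real.sqrt s) * Real.sqrt ((K : ℝ) - k) + C * γ * θ / (1 - θ) ^ 2 := by
    have h1 := mul_le_mul_of_nonneg_left hdouble hC
    have h2 : C * (1 / (1 - θ) * ∑ i ∈ Ico k K, r i) ≤ 2 * C / ((1 - θ) * Real.sqrt s) * Real.sqrt ((K : ℝ) - k) := by
      have := mul_le_mul_of_nonneg_left hsqrt (show 0 ≤ C * (1 / (1 - θ)) by positivity)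
      calc C * (1 / (1 - θ) * ∑ i ∈ Ico k K, r i) = C * (1 / (1 - θ)) * ∑ i ∈ Ico k K, r i := by ring
        _ ≤ C * (1 / (1 - θ)) * (2 * Real.sqrt ((K : ℝ) - k) / Real.sqrt s) := this
        _ = 2 * C / ((1 - θ) * Real.sqrt s) * Real.sqrt ((K : ℝ) - k) := by
            field_simp
    have h3 : C * (1 / (1 - θ) * ∑ i ∈ Ico k K, r i + γ * θ / (1 - θ) ^ 2) =
        C * (1 / (1 - θ) * ∑ i ∈ Ico k K, r i) + C * γ * θ / (1 - θ) ^ 2 := by ring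
    linarith [h1, h2, h3]
  have h' := abs_le.mp (habs.trans (by linarith [hCd] : (K - k : ℝ) * (C * δ / (1 - θ)) +
      C * ∑ j ∈ Ico k K, ∑ i ∈ range (j + 1), θ ^ (j - i) * r i ≤
      C * δ / (1 - θ) * ((K : ℝ) - k) + 2 * C / ((1 - θ) * Real.sqrt s) * Real.sqrt ((K : ℝ) - k) + C * γ * θ / (1 - θ) ^ 2))
  constructor <;> linarith [h'.1, h'.2, h31.1, h31.2]

/-! ## §3 All windows: a family of (0.31)-runs, one per depth, forces two-sided linear drift of the constant-history sequence and the averaged-AF carrier -/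

/-- **TWO-SIDED LINEAR DRIFT OF THE CONSTANT-HISTORY SEQUENCE.**  Node U2's moduli on ]0, γ] (0 ≤ θ < 1), `0 < δ ≤ γ`, and for EVERY depth K some run of (0.20) inside ]0, γ] obeying the
discrete two-sided (0.31) with slopes `0 < s ≤ s′` relative to ITS OWN endpoint (whatever it is) ⟹ for ALL k, N:
`s·N − E(N) ≤ Σ_{j∈[k,k+N)} β_{j+1}(δ, …, δ) ≤ s′·N + E(N)`, `E(N) = (Cδ∕(1−θ))N + (2C∕((1−θ)√s))√N + Cγθ∕(1−θ)²` (`constDrift_window` on the lattice K = k + N; the reference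
sequence does not depend on the run, so ONE run per depth suffices). [cite: Balaban1987RG1, (0.20) p.256 and (0.31) p.259] -/
theorem constDrift_of_runs {β : HBeta} {γ C θ δ s s' : ℝ} {Λ : ℕ → ℕ → ℝ} (hL : HistLipschitz Λ γ β) (hΛ : FadingMemory C θ Λ)
    (hθ0 : 0 ≤ θ) (hθ1 : θ < 1) (hC : 0 ≤ C) (hδ : 0 < δ) (hδγ : δ ≤ γ) (hs : 0 < s)
    (hruns : ∀ K : ℕ, ∃ r : ℕ → ℝ, RGEqH K β r ∧ Step.InInterval γ K r ∧ Step.Discrete031 s s' K (r K) r) (k N : ℕ) :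
    s * N - (C * δ / (1 - θ) * N + 2 * C / ((1 - θ) * Real.sqrt s) * Real.sqrt N + C * γ * θ / (1 - θ) ^ 2)
        ≤ ∑ j ∈ Ico k (k + N), β j (fun _ : Fin (j + 1) => δ) ∧
      ∑ j ∈ Ico k (k + N), β j (fun _ : Fin (j + 1) => δ)
        ≤ s' * N + (C * δ / (1 - θ) * N + 2 * C / ((1 - θ) * Real.sqrt s) * Real.sqrt N + C * γ * θ / (1 - θ) ^ 2) := by
  obtain ⟨r, hrg, hI, hD⟩ := hruns (k + N)
  have h := constDrift_window hL hΛ hθ0 hθ1 hC hδ hδγ hs hrg hI hD (Nat.le_add_right k N)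
  have hcast : (((k + N : ℕ) : ℝ) - k) = (N : ℝ) := by push_cast; ring
  rw [hcast] at h
  exact h

/-- The square-root defect absorbed: `A√N ≤ (s∕4)N + A²∕s` for `s > 0`. [folklore] -/
theorem sqrt_absorb {A s : ℝ} (hs : 0 < s) (N : ℕ) : A * Real.sqrt N ≤ s / 4 * N + A ^ 2 / s := by
  have hsN : Real.sqrt (N : ℝ) ^ 2 = N := Real.sq_sqrt (Nat.cast_nonneg N)
  have key : 0 ≤ s / 4 * Real.sqrt N ^ 2 - A * Real.sqrt N + A ^ 2 / s := by
    have e : s / 4 * Real.sqrt N ^ 2 - A * Real.sqrt N + A ^ 2 / s = (Real.sqrt N * s / 2 - A) ^ 2 / s := by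
      field_simp; ring
    rw [e]; positivity
  rw [hsN] at key
  linarith

/-- **CREW CAP's AVERAGED-AF CARRIER FROM A FAMILY OF (0.31)-RUNS UNDER FADING MEMORY (kernel of the END).**  Same hypotheses + the box smallness `4Cδ ≤ s(1−θ)` ⟹
`BetaAvgAFH (s∕4) (4C²∕((1−θ)²s²) + Cγθ∕(1−θ)²) δ β`: along EVERY ]0, δ]-history every window sum of β is ≥ (s∕4)(n − k) − D — each of its terms is within `Cδ∕(1−θ) ≤ s∕4` of the
constant-history value (`abs_sub_const_le_of_small`), whose windows drift by `constDrift_of_runs` (run-side transfer `Cδ∕(1−θ) ≤ s∕4` per term), and `(2C∕((1−θ)√s))√N ≤ (s∕4)N + 4C²∕((1−θ)²s²)`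
(`sqrt_absorb`). [cite: Balaban1987RG1, Thm 2 (0.31) p.259 with (0.20) p.256 and §5 p.298] -/
theorem betaAvgAFH_of_runs_fadingMemory {β : HBeta} {γ C θ δ s s' : ℝ} {Λ : ℕ → ℕ → ℝ} (hL : HistLipschitz Λ γ β) (hΛ : FadingMemory C θ Λ)
    (hθ0 : 0 ≤ θ) (hθ1 : θ < 1) (hC : 0 ≤ C) (hδ : 0 < δ) (hδγ : δ ≤ γ) (hs : 0 < s) (hsmall : 4 * C * δ ≤ s * (1 - θ))
    (hruns : ∀ K : ℕ, ∃ r : ℕ → ℝ, RGEqH K β r ∧ Step.InInterval γ K r ∧ Step.Discrete031 s s' K (r K) r) :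
    BetaAvgAFH (s / 4) (4 * C ^ 2 / ((1 - θ) ^ 2 * s ^ 2) + C * γ * θ / (1 - θ) ^ 2) δ β := by
  intro v hv k n hkn
  obtain ⟨N, rfl⟩ : ∃ N, n = k + N := ⟨n - k, by omega⟩
  have h1θ : 0 < 1 - θ := by linarith
  have hCδ : C * δ / (1 - θ) ≤ s / 4 := by rw [div_le_iff₀ h1θ]; linarith
  -- each term of the history's window is ≥ the constant-history value − Cδ/(1−θ)
  have hterm : ∀ j ∈ Ico k (k + N), β j (fun _ : Fin (j + 1) => δ) - C * δ / (1 - θ) ≤ β j (prefixOf v j) := by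
    intro j _
    have h := (abs_le.mp (abs_sub_const_le_of_small hL hΛ hθ0 hθ1 hC hδ hδγ (j := j) hv)).1
    linarith
  have hsumterm : ∑ j ∈ Ico k (k + N), (β j (fun _ : Fin (j + 1) => δ) - C * δ / (1 - θ)) ≤ ∑ j ∈ Ico k (k + N), β j (prefixOf v j) :=
    Finset.sum_le_sum hterm
  rw [Finset.sum_sub_distrib, Finset.sum_const, Nat.card_Ico, nsmul_eq_mul, Nat.add_sub_cancel_left] at hsumterm
  -- the constant-history windows drift
  have hlow := (constDrift_of_runs hL hΛ hθ0 hθ1 hC hδ hδγ hs hruns k N).1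
  have habsorb := sqrt_absorb (A := 2 * C / ((1 - θ) * Real.sqrt s)) hs N
  have hA2 : (2 * C / ((1 - θ) * Real.sqrt s)) ^ 2 / s = 4 * C ^ 2 / ((1 - θ) ^ 2 * s ^ 2) := by
    have hss : Real.sqrt s ^ 2 = s := Real.sq_sqrt hs.le
    have hsq : Real.sqrt s ≠ 0 := (Real.sqrt_pos.mpr hs).ne'
    field_simp
    rw [hss]; ring
  rw [hA2] at habsorb
  have hN0 : (0 : ℝ) ≤ N := Nat.cast_nonneg N
  have hNC : (N : ℝ) * (C * δ / (1 - θ)) ≤ (N : ℝ) * (s / 4) := mul_le_mul_of_nonneg_left hCδ hN0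
  have hNC' : C * δ / (1 - θ) * (N : ℝ) ≤ s / 4 * N := by linarith
  have hcastN : (((k + N : ℕ) : ℝ) - k) = (N : ℝ) := by push_cast; ring
  rw [hcastN]
  linarith [hlow, hsumterm, habsorb, hNC, hNC']

/-! ## §4 On the as-printed carrier: the TYPED Theorem 2 + fading memory force crew CAP's carrier near zero -/

variable {S : Setting}

/-- **THE RUN FAMILY OF THE TYPED THEOREM 2 AT ONE ENDPOINT.**  `Theorem2Statement S hL` AS TYPED (constants β, β′ chosen AFTER g) and prover 1's binder `hrg` on ]0, γ_U] ⟹ some slopes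
`0 < s ≤ s′` (= β(g₁) ln L, β′(g₁) ln L at ONE admissible endpoint g₁ of the box min(γ₀, γ_U)) and, for every depth K, a run of (0.20) inside ]0, γ_U] with `Step.Discrete031 s s′ K (r_K) r` — the
hypothesis `hruns` of §3 (`…B12AsPrintedUpper.tunedRuns_of_theorem2Statement` BY NAME at m = 0). [cite: Balaban1987RG1, Thm 2 (0.31) p.259 with (0.20) p.256] -/
theorem runs_of_theorem2 {hL : Odd S.L ∧ 1 < S.L} (hT : Theorem2Statement S hL) {γU : ℝ} (hγU : 0 < γU)
    (hrg : ∀ P : B12.RunParams, Step.InInterval γU P.K (S.cpl P) → RGEqH P.K S.β (S.cpl P)) :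
    ∃ s s' : ℝ, 0 < s ∧ s ≤ s' ∧
      ∀ K : ℕ, ∃ r : ℕ → ℝ, RGEqH K S.β r ∧ Step.InInterval γU K r ∧ Step.Discrete031 s s' K (r K) r := by
  have hlog : 0 < Real.log (S.L : ℝ) := Real.log_pos (by exact_mod_cast hL.2)
  obtain ⟨γ₀, hγ₀, hγ⟩ := tunedRuns_of_theorem2Statement hT 0
  obtain ⟨g₁, hg₁, hg⟩ := hγ (min γ₀ γU) (lt_min hγ₀ hγU) (min_le_left _ _)
  obtain ⟨β, β', hβ, hββ', hK⟩ := hg g₁ hg₁ le_rfl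
  refine ⟨β * Real.log S.L, β' * Real.log S.L, mul_pos hβ hlog, mul_le_mul_of_nonneg_right hββ' hlog.le, fun K => ?_⟩
  obtain ⟨g₀, hI, hend, hDisc⟩ := hK K
  have hIU : Step.InInterval γU K (S.cpl ⟨K, 0, g₀⟩) := fun i hi => ⟨(hI i hi).1, (hI i hi).2.trans (min_le_right _ _)⟩
  refine ⟨S.cpl ⟨K, 0, g₀⟩, hrg ⟨K, 0, g₀⟩ hIU, hIU, ?_⟩
  rw [hend]; exact hDisc

/-- **THE TYPED THEOREM 2 + node U2's FADING MEMORY FORCE crew CAP's AVERAGED-AF CARRIER NEAR ZERO.**  `Theorem2Statement S hL` AS TYPED + `hrg` on ]0, γ_U] + `HistLipschitz Λ γ_U S.β` with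
`FadingMemory C θ Λ` (0 ≤ θ < 1, 0 ≤ C) ⟹ there is a slope s > 0 (from ONE endpoint, `runs_of_theorem2`) and a defect D such that for EVERY box size `0 < δ ≤ γ_U` with `4Cδ ≤ s(1−θ)`:
`BetaAvgAFH (s∕4) D δ S.β` — the letter socket e3's certified slice instantiates is NECESSARY for Theorem 2 EVEN AS TYPED under node U2's moduli alone: part 6d (#60e) needed the g-UNIFORM reading
(and got slope loss, defect 0), part 9b (#61j) needed (AF-1) (face transfer); here neither — the run is moved to the constant history coordinate by coordinate, the pre-window history fading out.
Equivalently: the TYPED (0.31)'s lower half is AUTOMATICALLY g-UNIFORM up to a defect on every small box (all histories, not only runs).  NOT pointwise: the ramp setting of part 8b (#61g) has every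
hypothesis here and β_2(δ, δ∕3) < 0. [cite: Balaban1987RG1, Thm 2 (0.31) p.259 with (0.20) p.256 and §5 p.298] -/
theorem betaAvgAFH_of_theorem2_fadingMemory {hL : Odd S.L ∧ 1 < S.L} (hT : Theorem2Statement S hL)
    {γU C θ : ℝ} {Λ : ℕ → ℕ → ℝ} (hγU : 0 < γU) (hθ0 : 0 ≤ θ) (hθ1 : θ < 1) (hC : 0 ≤ C)
    (hrg : ∀ P : B12.RunParams, Step.InInterval γU P.K (S.cpl P) → RGEqH P.K S.β (S.cpl P))
    (hLip : HistLipschitz Λ γU S.β) (hΛ : FadingMemory C θ Λ) :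
    ∃ s : ℝ, 0 < s ∧ ∃ D : ℝ, ∀ δ : ℝ, 0 < δ → δ ≤ γU → 4 * C * δ ≤ s * (1 - θ) → BetaAvgAFH (s / 4) D δ S.β := by
  obtain ⟨s, s', hs, -, hruns⟩ := runs_of_theorem2 hT hγU hrg
  exact ⟨s, hs, 4 * C ^ 2 / ((1 - θ) ^ 2 * s ^ 2) + C * γU * θ / (1 - θ) ^ 2, fun δ hδ hδγ hsmall =>
    betaAvgAFH_of_runs_fadingMemory hLip hΛ hθ0 hθ1 hC hδ hδγ hs hsmall hruns⟩

/-- **Existential form**: the typed Theorem 2 + `hrg` + node U2's fading-memory moduli ⟹ `∃ s > 0, ∃ D, ∃ δ > 0, BetaAvgAFH s D δ S.β` (δ = min(γ_U, s(1−θ)∕(4(C+1)))).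
[cite: Balaban1987RG1, Thm 2 (0.31) p.259 with (0.20) p.256 and §5 p.298] -/
theorem exists_betaAvgAFH_of_theorem2_fadingMemory {hL : Odd S.L ∧ 1 < S.L} (hT : Theorem2Statement S hL)
    {γU C θ : ℝ} {Λ : ℕ → ℕ → ℝ} (hγU : 0 < γU) (hθ0 : 0 ≤ θ) (hθ1 : θ < 1) (hC : 0 ≤ C)
    (hrg : ∀ P : B12.RunParams, Step.InInterval γU P.K (S.cpl P) → RGEqH P.K S.β (S.cpl P))
    (hLip : HistLipschitz Λ γU S.β) (hΛ : FadingMemory C θ Λ) :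
    ∃ s : ℝ, 0 < s ∧ ∃ D δ : ℝ, 0 < δ ∧ δ ≤ γU ∧ BetaAvgAFH s D δ S.β := by
  obtain ⟨s, hs, D, h⟩ := betaAvgAFH_of_theorem2_fadingMemory hT hγU hθ0 hθ1 hC hrg hLip hΛ
  have h1θ : 0 < 1 - θ := by linarith
  set δ : ℝ := min γU (s * (1 - θ) / (4 * (C + 1))) with hδdef
  have hδpos : 0 < δ := lt_min hγU (by positivity)
  have hδγ : δ ≤ γU := min_le_left _ _
  have hsmall : 4 * C * δ ≤ s * (1 - θ) := by
    have h1 : δ ≤ s * (1 - θ) / (4 * (C + 1)) := min_le_right _ _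
    have h2 : 4 * (C + 1) * δ ≤ s * (1 - θ) := by rwa [le_div_iff₀ (by positivity), mul_comm] at h1
    nlinarith [hδpos.le]
  exact ⟨s / 4, by positivity, D, δ, hδpos, hδγ, h δ hδpos hδγ hsmall⟩

/-- The same with prover 1's binder `hrg` DISCHARGED from the printed `Definitions` and the upper letter (U) `β_{k+1} ≤ M` on ]0, γ_U]^{k+1} with Mγ_U² < 1 (`…TunedUpper.hrg_of_betaUpperH`).
[cite: Balaban1987RG1, Thm 2 (0.31) p.259 with (0.20) p.256 and §1 p.264] -/
theorem exists_betaAvgAFH_of_theorem2_fadingMemory' {hL : Odd S.L ∧ 1 < S.L} (hT : Theorem2Statement S hL) (hDef : Definitions S)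
    {γU C θ M : ℝ} {Λ : ℕ → ℕ → ℝ} (hγU : 0 < γU) (hθ0 : 0 ≤ θ) (hθ1 : θ < 1) (hC : 0 ≤ C)
    (hub : BetaUpperH M γU S.β) (hMγ : M * γU ^ 2 < 1) (hLip : HistLipschitz Λ γU S.β) (hΛ : FadingMemory C θ Λ) :
    ∃ s : ℝ, 0 < s ∧ ∃ D δ : ℝ, 0 < δ ∧ δ ≤ γU ∧ BetaAvgAFH s D δ S.β :=
  exists_betaAvgAFH_of_theorem2_fadingMemory hT hγU hθ0 hθ1 hC (hrg_of_betaUpperH hDef hγU hub hMγ) hLip hΛ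

/-! ## §5 Read-out: the typed (0.31)'s lower half is automatically g-UNIFORM up to a defect on small boxes -/

/-- **THE CARRIER ALONG ANY RUN: (0.31)'s lower half with a defect.**  `BetaAvgAFH s D δ β` and a run of (0.20) inside ]0, δ] up to K ⟹ `1∕r_K² + s(K − k) − D ≤ 1∕r_k²` for every k ≤ K
(`BetaAvgAFH.onHorizon` + telescoped (0.20); the HBeta-level form of #57c `…B12AsPrintedAvgAF.lower_running_of_avgAFH`). [cite: Balaban1987RG1, Thm 2 (0.31) p.259 with (0.20) p.256] -/
theorem lower_running_of_avgAFH_run {β : HBeta} {s D δ : ℝ} (h : BetaAvgAFH s D δ β) {K : ℕ} {r : ℕ → ℝ} (hrg : RGEqH K β r)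
    (hI : Step.InInterval δ K r) {k : ℕ} (hk : k ≤ K) :
    1 / (r K) ^ 2 + s * ((K : ℝ) - k) - D ≤ 1 / (r k) ^ 2 := by
  have hw := h.onHorizon r K hI k K hk le_rfl
  have ht := inv_sq_telescopeH hrg hk le_rfl
  linarith

/-- **AUTOMATIC UNIFORMITY.**  `Theorem2Statement S hL` AS TYPED (constants β(g), β′(g) chosen AFTER g) + `hrg` + node U2's fading-memory moduli on ]0, γ_U] ⟹ there are ONE slope s > 0,
ONE defect D and a box δ ∈ ]0, γ_U] such that EVERY run of the setting lying in ]0, δ] (any torus exponent, any depth, any bare coupling — in particular every tuned run of Theorem 2 with a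
small endpoint) obeys the lower half of (0.31) with these g-INDEPENDENT constants up to the defect: `1∕g_K² + s(K − k) − D ≤ 1∕g_k²`, k ≤ K.  In the typed reading the slope β(g) may
degenerate as g → 0 (part 8b's ramp: it must); on small boxes the moduli restore a uniform slope at the price of a defect. [cite: Balaban1987RG1, Thm 2 (0.31) p.259 with (0.20) p.256 and §5 p.298] -/
theorem uniformLowerRunning_of_theorem2_fadingMemory {hL : Odd S.L ∧ 1 < S.L} (hT : Theorem2Statement S hL)
    {γU C θ : ℝ} {Λ : ℕ → ℕ → ℝ} (hγU : 0 < γU) (hθ0 : 0 ≤ θ) (hθ1 : θ < 1) (hC : 0 ≤ C)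
    (hrg : ∀ P : B12.RunParams, Step.InInterval γU P.K (S.cpl P) → RGEqH P.K S.β (S.cpl P))
    (hLip : HistLipschitz Λ γU S.β) (hΛ : FadingMemory C θ Λ) :
    ∃ s : ℝ, 0 < s ∧ ∃ D δ : ℝ, 0 < δ ∧ δ ≤ γU ∧ ∀ P : B12.RunParams, Step.InInterval δ P.K (S.cpl P) →
      ∀ k, k ≤ P.K → 1 / (S.cpl P P.K) ^ 2 + s * ((P.K : ℝ) - k) - D ≤ 1 / (S.cpl P k) ^ 2 := by
  obtain ⟨s, hs, D, δ, hδ, hδγ, h⟩ := exists_betaAvgAFH_of_theorem2_fadingMemory hT hγU hθ0 hθ1 hC hrg hLip hΛ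
  refine ⟨s, hs, D, δ, hδ, hδγ, fun P hI k hk => ?_⟩
  have hIU : Step.InInterval γU P.K (S.cpl P) := fun i hi => ⟨(hI i hi).1, (hI i hi).2.trans hδγ⟩
  exact lower_running_of_avgAFH_run h (hrg P hIU) hI hk

end

end Summit.QuantumFields.BalabanUV.Beta.EriceFlowEnclosureB12AsPrintedPointwiseFadingDrift
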